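import Mathlib
import Summits.NavierStokesRegularity.NavierStokesRegularity.Theorems.EulerZoomLiouvillePowerGaugeEulerLiouvilleSelfSimilarPastExtension
import Summits.NavierStokesRegularity.NavierStokesRegularity.Theorems.EulerZoomLiouvillePowerGaugeEulerLiouvilleSelfSimilarIrrotationalGrowth
import Summits.NavierStokesRegularity.NavierStokesRegularity.Theorems.EulerZoomLiouvillePowerGaugeEulerLiouvilleSelfSimilarRadialBarrierLoc
import Summits.NavierStokesRegularity.NavierStokesRegularity.Theorems.EulerZoomLiouvillePowerGaugeEulerLiouvilleSelfSimilarUniformlyContinuousLoc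
import Summits.NavierStokesRegularity.NavierStokesRegularity.Theorems.EulerZoomLiouvillePowerGaugeEulerLiouvilleAllRhoStrata
import Literature.Analysis.FluidPDE.SelfSimilarEulerVorticityCompactSupport
import HarnessLib

/-!
# PAST-EXACT self-similar members with a TAME `C²` profile are trivial: profile zero ⇒ quiescent past ⇒ the crux's energy stratum
# (crux `EulerZoomLiouville.PowerGaugeEulerLiouville` = stmt-NavierStokesRegularity-19832, line `birth`, rung C1)

Route `EulerZoomLiouville` (NavierStokesRegularity).  Interim LEAD ns-typeII-p2 g9; sequel of `…SelfSimilarPastExtension`.  A class member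
`(u, p, H, c)` that is exactly self-similar about `(T, x₀)` ON A PAST SUB-SLAB `τ < T₁` only (`T₁ ≤ 0`, `T₁ ≤ T`; arbitrary on `[T₁, 0)` — e.g. a
self-similar blow-up at an interior time `T < 0` followed by any weak continuation) and whose velocity profile is `C²` and TAME — no fast radial
inflow at infinity (ns-typeII-p1 g8's barrier `Loc.curl_eq_zero_of_radialInflow`), or uniformly continuous (p1 g8's spike estimate), or
irrotational, or with compactly supported vorticity — has PROFILE ZERO (`Past.profile_eq_zero_of_…`: the origin-centred extension from the far
past makes the profile weakly divergence free and supplies CIV (3.3); the dynamical levers give `curl V ≡ 0`; the `A`-gauge read on the far-past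
slice gives the sub-volume growth that kills harmonic components — `Loc.eq_zero_of_curl_eq_zero_of_growth`).  Hence `u ≡ 0` on `(−∞, T₁)`, the
past is energy-quiescent, and the crux's filled stratum `ae_eq_zero_of_gauge_of_energyVanishing_allRho` (`stub_quiescentPast`) makes the
member vanish on the WHOLE slab (`Past.ae_eq_zero_of_profile_eq_zero`).

* `Past.profile_eq_zero_of_irrotationalC2` / `…_of_radialInflowC2` / `…_of_uniformContinuousC2` / `…_of_compactCurlC2` — profile level (`V = 0`);
* `Past.ae_eq_zero_of_profile_eq_zero` — member level from `V = 0` (quiescent past);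
* `Past.selfSimilar_ae_eq_zero_of_{irrotational,radialInflow,uniformContinuous,compactCurl}C2_profile` — MEMBER LEVEL, crux hypotheses verbatim
  (`0 < ρ ≤ ½`) + past-exact self-similarity + the profile hypothesis ⇒ `u = 0` a.e. on `(−∞,0) × ℝ³`.

WHAT THIS IS NOT: not NS, not E — classical sub-strata `--supports` stmt-19832 (the `T₁ = 0` case is the shifted stratum; the critically
homogeneous profile is NOT covered here: a past-steady member need not be steady); the weak class and members that are nowhere exactly
self-similar stay OPEN. [folklore]
-/

noncomputable section

-- flat `Theorems/<Route><Decl>…` files of one crux share the namespace of the crux (tree convention: `Summit.<S>.<S>.…`)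
set_option linter.dupNamespace false

open MeasureTheory Set Filter Topology Metric Function InnerProductSpace TopologicalSpace
open scoped RealInnerProductSpace NNReal ENNReal ContDiff

namespace Summit.NavierStokesRegularity.NavierStokesRegularity.Theorems.PowerGaugeEulerLiouville

open Literature.Analysis Literature.Analysis.FunctionSpaces Literature.Analysis.FluidPDE

namespace Past

variable {ρ T T₁ : ℝ} {x₀ : EuclideanSpace ℝ (Fin 3)}
  {u : ℝ → EuclideanSpace ℝ (Fin 3) → EuclideanSpace ℝ (Fin 3)} {p : ℝ → EuclideanSpace ℝ (Fin 3) → ℝ}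
  {H : ℝ → EuclideanSpace ℝ (Fin 3) → EuclideanSpace ℝ (Fin 3) →L[ℝ] EuclideanSpace ℝ (Fin 3)} {c : ℝ≥0}
  {V : EuclideanSpace ℝ (Fin 3) → EuclideanSpace ℝ (Fin 3)} {P : EuclideanSpace ℝ (Fin 3) → ℝ}

/-! ### Profile level: `V = 0` -/

/-- **Past-exact member with IRROTATIONAL `C²` profile: the profile is ZERO** (`0 < ρ ≤ ½`; no growth hypothesis): the extension from the far
past makes `V` divergence free, the far-past `A`-gauge gives `∫_{B_L}‖V‖² ≤ C L^{1−2ρ}` at all scales, and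
`Loc.eq_zero_of_curl_eq_zero_of_growth` applies. [folklore] -/
theorem profile_eq_zero_of_irrotationalC2 (hρ : 0 < ρ) (hρh : ρ ≤ 1 / 2) (hT₁ : T₁ ≤ 0) (hTT₁ : T₁ ≤ T)
    (hsol : IsDistributionalNSSolutionOn (slab (EuclideanSpace ℝ (Fin 3)) (Iio 0) isOpen_Iio) 0 0 u p)
    (hA : ∀ a : ℝ, 0 < a → ENNReal.ofReal (a ^ (2 * ρ)) *
      cknA a (0 : ℝ × EuclideanSpace ℝ (Fin 3)) u ≤ (c : ℝ≥0∞))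
    (hu : ∀ τ : ℝ, τ < T₁ → u τ = fun x => selfSimilarCollapse (1 / (2 + ρ)) T V τ (x - x₀))
    (hp : ∀ τ : ℝ, τ < T₁ → p τ = fun x => selfSimilarCollapsePressure (1 / (2 + ρ)) T P τ (x - x₀))
    (hV : ContDiff ℝ 2 V) (hcurl : ∀ x, curl V x = 0) : V = 0 := by
  have hext := Shifted.isDistributional_selfSimilarCollapse_of_past hT₁ hTT₁ x₀ hsol hu hp
  have hdivw : IsWeaklyDivFree V :=
    ProfileEquation.profile_isWeaklyDivFree hext (fun _ _ => rfl) hV.continuous.locallyIntegrable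
  have hdiv : VectorCalculus.IsDivFree V := hdivw.isDivFree_of_contDiff (hV.of_le (by norm_num))
  obtain ⟨C, hC, hgrowth⟩ := Shifted.profile_energy_growth_of_gaugeA_past hρ hρh hT₁ hTT₁ x₀ hu hA
  obtain ⟨C', hC', hgrowth'⟩ := Shifted.growth_of_growth_le hV.continuous (θ := 1 - 2 * ρ) (by linarith)
    (L₀ := 2 - T₁) (by linarith) hC hgrowth
  exact Loc.eq_zero_of_curl_eq_zero_of_growth hV hcurl hdiv hC' (θ := 1 - 2 * ρ) (by linarith) hgrowth'

/-- The classical profile equation of a past-exact member with `C²` velocity profile: CIV (3.3) for some `C¹` pressure (extension from the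
far past, `P ∈ L¹_loc` from the slab, `WeakToClassical`). [folklore] -/
theorem exists_isSelfSimilarEulerProfile (hρ : 0 < ρ) (hT₁ : T₁ ≤ 0) (hTT₁ : T₁ ≤ T)
    (hsol : IsDistributionalNSSolutionOn (slab (EuclideanSpace ℝ (Fin 3)) (Iio 0) isOpen_Iio) 0 0 u p)
    (hu : ∀ τ : ℝ, τ < T₁ → u τ = fun x => selfSimilarCollapse (1 / (2 + ρ)) T V τ (x - x₀))
    (hp : ∀ τ : ℝ, τ < T₁ → p τ = fun x => selfSimilarCollapsePressure (1 / (2 + ρ)) T P τ (x - x₀))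
    (hV : ContDiff ℝ 2 V) :
    ∃ P' : EuclideanSpace ℝ (Fin 3) → ℝ, IsSelfSimilarEulerProfile (1 / (2 + ρ)) 0 V P' := by
  have h2ρ : (0 : ℝ) < 2 + ρ := by linarith
  have hγ : (0 : ℝ) < 1 / (2 + ρ) := one_div_pos.2 h2ρ
  have hγ2 : 1 / (2 + ρ) < 1 / 2 := one_div_lt_one_div_of_lt two_pos (by linarith)
  have hext := Shifted.isDistributional_selfSimilarCollapse_of_past hT₁ hTT₁ x₀ hsol hu hp
  have hpm : AEStronglyMeasurable (uncurry (selfSimilarCollapsePressure (1 / (2 + ρ)) 0 P))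
      (volume.restrict (Iio (0 : ℝ) ×ˢ (univ : Set (EuclideanSpace ℝ (Fin 3))))) := by
    have := hext.2.2.1.aestronglyMeasurable
    simpa [slab] using this
  have hPm : AEStronglyMeasurable P volume :=
    aestronglyMeasurable_pressureProfile (p := selfSimilarCollapsePressure (1 / (2 + ρ)) 0 P) hpm fun _ _ => rfl
  have hP1 : LocallyIntegrable P volume :=
    Shifted.locallyIntegrable_pressureProfile_of_slab hγ.le (by linarith) hPm hext.2.2.1
  exact WeakToClassical.exists_isSelfSimilarEulerProfile_of_contDiff hext (fun _ _ => rfl) (fun _ _ => rfl) hV hP1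

/-- **Past-exact member, `C²` profile without fast radial inflow at infinity: the profile is ZERO** (`0 < ρ ≤ ½`; ns-typeII-p1 g8's one-sided
barrier `Loc.curl_eq_zero_of_radialInflow` on the derived classical profile, then the irrotational case). [folklore] -/
theorem profile_eq_zero_of_radialInflowC2 (hρ : 0 < ρ) (hρh : ρ ≤ 1 / 2) (hT₁ : T₁ ≤ 0) (hTT₁ : T₁ ≤ T)
    (hsol : IsDistributionalNSSolutionOn (slab (EuclideanSpace ℝ (Fin 3)) (Iio 0) isOpen_Iio) 0 0 u p)
    (hA : ∀ a : ℝ, 0 < a → ENNReal.ofReal (a ^ (2 * ρ)) *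
      cknA a (0 : ℝ × EuclideanSpace ℝ (Fin 3)) u ≤ (c : ℝ≥0∞))
    (hu : ∀ τ : ℝ, τ < T₁ → u τ = fun x => selfSimilarCollapse (1 / (2 + ρ)) T V τ (x - x₀))
    (hp : ∀ τ : ℝ, τ < T₁ → p τ = fun x => selfSimilarCollapsePressure (1 / (2 + ρ)) T P τ (x - x₀))
    (hV : ContDiff ℝ 2 V) {κ R₁ : ℝ} (hκ : κ < 1 / (2 + ρ))
    (hR₁ : ∀ y : EuclideanSpace ℝ (Fin 3), R₁ ≤ ‖y‖ → -(κ * ‖y‖ ^ 2) ≤ ⟪y, V y⟫) : V = 0 := by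
  have h2ρ : (0 : ℝ) < 2 + ρ := by linarith
  have hγ : (0 : ℝ) < 1 / (2 + ρ) := one_div_pos.2 h2ρ
  have hγ2 : 1 / (2 + ρ) < 1 / 2 := one_div_lt_one_div_of_lt two_pos (by linarith)
  obtain ⟨P', hprof⟩ := exists_isSelfSimilarEulerProfile hρ hT₁ hTT₁ hsol hu hp hV
  have hcurl : ∀ x, curl V x = 0 := fun x => Loc.curl_eq_zero_of_radialInflow hprof hκ hR₁ hγ hγ2 x
  exact profile_eq_zero_of_irrotationalC2 hρ hρh hT₁ hTT₁ hsol hA hu hp hV hcurl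

/-- **Past-exact member, UNIFORMLY CONTINUOUS `C²` profile: the profile is ZERO** (`0 < ρ ≤ ½`; the far-past `A`-growth + ns-typeII-p1 g8's
spike estimate `Loc.sublinear_of_uniformContinuous_of_growth` give `o(|y|)`, hence no fast inflow, `Loc.radialInflow_of_subdrift`). [folklore] -/
theorem profile_eq_zero_of_uniformContinuousC2 (hρ : 0 < ρ) (hρh : ρ ≤ 1 / 2) (hT₁ : T₁ ≤ 0) (hTT₁ : T₁ ≤ T)
    (hsol : IsDistributionalNSSolutionOn (slab (EuclideanSpace ℝ (Fin 3)) (Iio 0) isOpen_Iio) 0 0 u p)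
    (hA : ∀ a : ℝ, 0 < a → ENNReal.ofReal (a ^ (2 * ρ)) *
      cknA a (0 : ℝ × EuclideanSpace ℝ (Fin 3)) u ≤ (c : ℝ≥0∞))
    (hu : ∀ τ : ℝ, τ < T₁ → u τ = fun x => selfSimilarCollapse (1 / (2 + ρ)) T V τ (x - x₀))
    (hp : ∀ τ : ℝ, τ < T₁ → p τ = fun x => selfSimilarCollapsePressure (1 / (2 + ρ)) T P τ (x - x₀))
    (hV : ContDiff ℝ 2 V) (hUC : UniformContinuous V) : V = 0 := by
  have h2ρ : (0 : ℝ) < 2 + ρ := by linarith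
  have hγ : (0 : ℝ) < 1 / (2 + ρ) := one_div_pos.2 h2ρ
  obtain ⟨C, hC, hgrowth⟩ := Shifted.profile_energy_growth_of_gaugeA_past hρ hρh hT₁ hTT₁ x₀ hu hA
  obtain ⟨C', hC', hgrowth'⟩ := Shifted.growth_of_growth_le hV.continuous (θ := 1 - 2 * ρ) (by linarith)
    (L₀ := 2 - T₁) (by linarith) hC hgrowth
  have hsub := Loc.sublinear_of_uniformContinuous_of_growth hUC hC' (θ := 1 - 2 * ρ) (by linarith) hgrowth'
  obtain ⟨R₁, hR₁⟩ := hsub (1 / (2 + ρ) / 2) (by positivity)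
  have hκ : 1 / (2 + ρ) / 2 < 1 / (2 + ρ) := by linarith
  exact profile_eq_zero_of_radialInflowC2 hρ hρh hT₁ hTT₁ hsol hA hu hp hV hκ (Loc.radialInflow_of_subdrift hR₁)

/-- **Past-exact member, `C²` profile with COMPACTLY SUPPORTED VORTICITY: the profile is ZERO** (`0 < ρ ≤ ½`; the Eulerian `p → 0` identity
`IsSelfSimilarEulerProfile.curl_eq_zero_of_hasCompactSupport` on the derived classical profile, then the irrotational case).
[cite: ChaeShvydkoy2013, §4 Thm. 4.1 (proof)] -/
theorem profile_eq_zero_of_compactCurlC2 (hρ : 0 < ρ) (hρh : ρ ≤ 1 / 2) (hT₁ : T₁ ≤ 0) (hTT₁ : T₁ ≤ T)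
    (hsol : IsDistributionalNSSolutionOn (slab (EuclideanSpace ℝ (Fin 3)) (Iio 0) isOpen_Iio) 0 0 u p)
    (hA : ∀ a : ℝ, 0 < a → ENNReal.ofReal (a ^ (2 * ρ)) *
      cknA a (0 : ℝ × EuclideanSpace ℝ (Fin 3)) u ≤ (c : ℝ≥0∞))
    (hu : ∀ τ : ℝ, τ < T₁ → u τ = fun x => selfSimilarCollapse (1 / (2 + ρ)) T V τ (x - x₀))
    (hp : ∀ τ : ℝ, τ < T₁ → p τ = fun x => selfSimilarCollapsePressure (1 / (2 + ρ)) T P τ (x - x₀))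
    (hV : ContDiff ℝ 2 V) (hΩc : HasCompactSupport (curl V)) : V = 0 := by
  have h2ρ : (0 : ℝ) < 2 + ρ := by linarith
  have hγ : (0 : ℝ) < 1 / (2 + ρ) := one_div_pos.2 h2ρ
  obtain ⟨P', hprof⟩ := exists_isSelfSimilarEulerProfile hρ hT₁ hTT₁ hsol hu hp hV
  have hcurl0 : curl V = 0 := hprof.curl_eq_zero_of_hasCompactSupport hγ hΩc
  exact profile_eq_zero_of_irrotationalC2 hρ hρh hT₁ hTT₁ hsol hA hu hp hV fun x => congrFun hcurl0 x

/-! ### Member level: profile zero ⇒ quiescent past ⇒ trivial -/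

/-- **A past-exact member with ZERO profile is trivial on the whole slab** (crux hypotheses verbatim, any `ρ ≥ 0`): it vanishes identically for
`τ < T₁`, so its past is energy-quiescent, and the crux's filled energy stratum `ae_eq_zero_of_gauge_of_energyVanishing_allRho`
(`stub_quiescentPast`) applies. [folklore] -/
theorem ae_eq_zero_of_profile_eq_zero {γ : ℝ} (hρ : 0 ≤ ρ)
    (hsw : IsSuitableWeakSolutionOn (slab (EuclideanSpace ℝ (Fin 3)) (Iio 0) isOpen_Iio) 0 0 u p)
    (hH : HasWeakSpatialGradientOn (slab (EuclideanSpace ℝ (Fin 3)) (Iio 0) isOpen_Iio) u H)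
    (hgauge : ∀ a : ℝ, 0 < a →
      ENNReal.ofReal (a ^ (2 * ρ)) * cknA a (0 : ℝ × EuclideanSpace ℝ (Fin 3)) u +
          ENNReal.ofReal (a ^ ρ) * cknE a (0 : ℝ × EuclideanSpace ℝ (Fin 3)) H +
        ENNReal.ofReal (a ^ (2 * ρ)) * cknD a (0 : ℝ × EuclideanSpace ℝ (Fin 3)) p ≤ (c : ℝ≥0∞))
    (hu : ∀ τ : ℝ, τ < T₁ → u τ = fun x => selfSimilarCollapse γ T V τ (x - x₀)) (hV0 : V = 0) :
    uncurry u =ᵐ[volume.restrict (Iio (0 : ℝ) ×ˢ (univ : Set (EuclideanSpace ℝ (Fin 3))))] 0 := by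
  refine ae_eq_zero_of_gauge_of_energyVanishing_allRho hρ hsw hH hgauge fun ε hε N => ?_
  -- the energy vanishes identically for `s < min (−N) T₁`
  have hsub : Iio (min (-N) T₁) ⊆ {s : ℝ | s < -N ∧ ∫⁻ x, ‖u s x‖ₑ ^ 2 ≤ ENNReal.ofReal ε} := by
    intro s hs
    rw [mem_Iio, lt_min_iff] at hs
    refine ⟨hs.1, ?_⟩
    have hus : ∀ x, u s x = 0 := fun x => by
      rw [hu s hs.2]
      simp [selfSimilarCollapse_apply, hV0]
    simp [hus]
  have hinf : volume (Iio (min (-N) T₁)) = (⊤ : ℝ≥0∞) := Real.volume_Iio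
  intro h0
  have := measure_mono_null hsub h0
  rw [hinf] at this
  exact ENNReal.top_ne_zero this

/-- **PAST-EXACT MEMBER WITH IRROTATIONAL `C²` PROFILE IS TRIVIAL** (crux hypotheses verbatim, `0 < ρ ≤ ½`, exact self-similarity about `(T, x₀)`
for `τ < T₁`, `T₁ ≤ 0`, `T₁ ≤ T`). [folklore] -/
theorem selfSimilar_ae_eq_zero_of_irrotationalC2_profile (hρ : 0 < ρ) (hρh : ρ ≤ 1 / 2) (hT₁ : T₁ ≤ 0) (hTT₁ : T₁ ≤ T)
    (x₀ : EuclideanSpace ℝ (Fin 3))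
    (hsw : IsSuitableWeakSolutionOn (slab (EuclideanSpace ℝ (Fin 3)) (Iio 0) isOpen_Iio) 0 0 u p)
    (hH : HasWeakSpatialGradientOn (slab (EuclideanSpace ℝ (Fin 3)) (Iio 0) isOpen_Iio) u H)
    (hgauge : ∀ a : ℝ, 0 < a →
      ENNReal.ofReal (a ^ (2 * ρ)) * cknA a (0 : ℝ × EuclideanSpace ℝ (Fin 3)) u +
          ENNReal.ofReal (a ^ ρ) * cknE a (0 : ℝ × EuclideanSpace ℝ (Fin 3)) H +
        ENNReal.ofReal (a ^ (2 * ρ)) * cknD a (0 : ℝ × EuclideanSpace ℝ (Fin 3)) p ≤ (c : ℝ≥0∞))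
    (hu : ∀ τ : ℝ, τ < T₁ → u τ = fun x => selfSimilarCollapse (1 / (2 + ρ)) T V τ (x - x₀))
    (hp : ∀ τ : ℝ, τ < T₁ → p τ = fun x => selfSimilarCollapsePressure (1 / (2 + ρ)) T P τ (x - x₀))
    (hV : ContDiff ℝ 2 V) (hcurl : ∀ x, curl V x = 0) :
    uncurry u =ᵐ[volume.restrict (Iio (0 : ℝ) ×ˢ (univ : Set (EuclideanSpace ℝ (Fin 3))))] 0 :=
  have hA : ∀ a : ℝ, 0 < a → ENNReal.ofReal (a ^ (2 * ρ)) *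
      cknA a (0 : ℝ × EuclideanSpace ℝ (Fin 3)) u ≤ (c : ℝ≥0∞) :=
    fun a ha => le_trans (le_trans le_self_add le_self_add) (hgauge a ha)
  ae_eq_zero_of_profile_eq_zero hρ.le hsw hH hgauge hu
    (profile_eq_zero_of_irrotationalC2 hρ hρh hT₁ hTT₁ hsw.distributional hA hu hp hV hcurl)

/-- **PAST-EXACT MEMBER, `C²` PROFILE WITHOUT FAST RADIAL INFLOW, IS TRIVIAL** (crux hypotheses verbatim, `0 < ρ ≤ ½`). [folklore] -/
theorem selfSimilar_ae_eq_zero_of_radialInflowC2_profile (hρ : 0 < ρ) (hρh : ρ ≤ 1 / 2) (hT₁ : T₁ ≤ 0) (hTT₁ : T₁ ≤ T)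
    (x₀ : EuclideanSpace ℝ (Fin 3))
    (hsw : IsSuitableWeakSolutionOn (slab (EuclideanSpace ℝ (Fin 3)) (Iio 0) isOpen_Iio) 0 0 u p)
    (hH : HasWeakSpatialGradientOn (slab (EuclideanSpace ℝ (Fin 3)) (Iio 0) isOpen_Iio) u H)
    (hgauge : ∀ a : ℝ, 0 < a →
      ENNReal.ofReal (a ^ (2 * ρ)) * cknA a (0 : ℝ × EuclideanSpace ℝ (Fin 3)) u +
          ENNReal.ofReal (a ^ ρ) * cknE a (0 : ℝ × EuclideanSpace ℝ (Fin 3)) H +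
        ENNReal.ofReal (a ^ (2 * ρ)) * cknD a (0 : ℝ × EuclideanSpace ℝ (Fin 3)) p ≤ (c : ℝ≥0∞))
    (hu : ∀ τ : ℝ, τ < T₁ → u τ = fun x => selfSimilarCollapse (1 / (2 + ρ)) T V τ (x - x₀))
    (hp : ∀ τ : ℝ, τ < T₁ → p τ = fun x => selfSimilarCollapsePressure (1 / (2 + ρ)) T P τ (x - x₀))
    (hV : ContDiff ℝ 2 V) {κ R₁ : ℝ} (hκ : κ < 1 / (2 + ρ))
    (hR₁ : ∀ y : EuclideanSpace ℝ (Fin 3), R₁ ≤ ‖y‖ → -(κ * ‖y‖ ^ 2) ≤ ⟪y, V y⟫) :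
    uncurry u =ᵐ[volume.restrict (Iio (0 : ℝ) ×ˢ (univ : Set (EuclideanSpace ℝ (Fin 3))))] 0 :=
  have hA : ∀ a : ℝ, 0 < a → ENNReal.ofReal (a ^ (2 * ρ)) *
      cknA a (0 : ℝ × EuclideanSpace ℝ (Fin 3)) u ≤ (c : ℝ≥0∞) :=
    fun a ha => le_trans (le_trans le_self_add le_self_add) (hgauge a ha)
  ae_eq_zero_of_profile_eq_zero hρ.le hsw hH hgauge hu
    (profile_eq_zero_of_radialInflowC2 hρ hρh hT₁ hTT₁ hsw.distributional hA hu hp hV hκ hR₁)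

/-- **PAST-EXACT MEMBER, UNIFORMLY CONTINUOUS `C²` PROFILE, IS TRIVIAL** (crux hypotheses verbatim, `0 < ρ ≤ ½`). [folklore] -/
theorem selfSimilar_ae_eq_zero_of_uniformContinuousC2_profile (hρ : 0 < ρ) (hρh : ρ ≤ 1 / 2) (hT₁ : T₁ ≤ 0) (hTT₁ : T₁ ≤ T)
    (x₀ : EuclideanSpace ℝ (Fin 3))
    (hsw : IsSuitableWeakSolutionOn (slab (EuclideanSpace ℝ (Fin 3)) (Iio 0) isOpen_Iio) 0 0 u p)
    (hH : HasWeakSpatialGradientOn (slab (EuclideanSpace ℝ (Fin 3)) (Iio 0) isOpen_Iio) u H)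
    (hgauge : ∀ a : ℝ, 0 < a →
      ENNReal.ofReal (a ^ (2 * ρ)) * cknA a (0 : ℝ × EuclideanSpace ℝ (Fin 3)) u +
          ENNReal.ofReal (a ^ ρ) * cknE a (0 : ℝ × EuclideanSpace ℝ (Fin 3)) H +
        ENNReal.ofReal (a ^ (2 * ρ)) * cknD a (0 : ℝ × EuclideanSpace ℝ (Fin 3)) p ≤ (c : ℝ≥0∞))
    (hu : ∀ τ : ℝ, τ < T₁ → u τ = fun x => selfSimilarCollapse (1 / (2 + ρ)) T V τ (x - x₀))
    (hp : ∀ τ : ℝ, τ < T₁ → p τ = fun x => selfSimilarCollapsePressure (1 / (2 + ρ)) T P τ (x - x₀))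
    (hV : ContDiff ℝ 2 V) (hUC : UniformContinuous V) :
    uncurry u =ᵐ[volume.restrict (Iio (0 : ℝ) ×ˢ (univ : Set (EuclideanSpace ℝ (Fin 3))))] 0 :=
  have hA : ∀ a : ℝ, 0 < a → ENNReal.ofReal (a ^ (2 * ρ)) *
      cknA a (0 : ℝ × EuclideanSpace ℝ (Fin 3)) u ≤ (c : ℝ≥0∞) :=
    fun a ha => le_trans (le_trans le_self_add le_self_add) (hgauge a ha)
  ae_eq_zero_of_profile_eq_zero hρ.le hsw hH hgauge hu
    (profile_eq_zero_of_uniformContinuousC2 hρ hρh hT₁ hTT₁ hsw.distributional hA hu hp hV hUC)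

/-- **PAST-EXACT MEMBER, `C²` PROFILE WITH COMPACTLY SUPPORTED VORTICITY, IS TRIVIAL** (crux hypotheses verbatim, `0 < ρ ≤ ½`). [folklore] -/
theorem selfSimilar_ae_eq_zero_of_compactCurlC2_profile (hρ : 0 < ρ) (hρh : ρ ≤ 1 / 2) (hT₁ : T₁ ≤ 0) (hTT₁ : T₁ ≤ T)
    (x₀ : EuclideanSpace ℝ (Fin 3))
    (hsw : IsSuitableWeakSolutionOn (slab (EuclideanSpace ℝ (Fin 3)) (Iio 0) isOpen_Iio) 0 0 u p)
    (hH : HasWeakSpatialGradientOn (slab (EuclideanSpace ℝ (Fin 3)) (Iio 0) isOpen_Iio) u H)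
    (hgauge : ∀ a : ℝ, 0 < a →
      ENNReal.ofReal (a ^ (2 * ρ)) * cknA a (0 : ℝ × EuclideanSpace ℝ (Fin 3)) u +
          ENNReal.ofReal (a ^ ρ) * cknE a (0 : ℝ × EuclideanSpace ℝ (Fin 3)) H +
        ENNReal.ofReal (a ^ (2 * ρ)) * cknD a (0 : ℝ × EuclideanSpace ℝ (Fin 3)) p ≤ (c : ℝ≥0∞))
    (hu : ∀ τ : ℝ, τ < T₁ → u τ = fun x => selfSimilarCollapse (1 / (2 + ρ)) T V τ (x - x₀))
    (hp : ∀ τ : ℝ, τ < T₁ → p τ = fun x => selfSimilarCollapsePressure (1 / (2 + ρ)) T P τ (x - x₀))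
    (hV : ContDiff ℝ 2 V) (hΩc : HasCompactSupport (curl V)) :
    uncurry u =ᵐ[volume.restrict (Iio (0 : ℝ) ×ˢ (univ : Set (EuclideanSpace ℝ (Fin 3))))] 0 :=
  have hA : ∀ a : ℝ, 0 < a → ENNReal.ofReal (a ^ (2 * ρ)) *
      cknA a (0 : ℝ × EuclideanSpace ℝ (Fin 3)) u ≤ (c : ℝ≥0∞) :=
    fun a ha => le_trans (le_trans le_self_add le_self_add) (hgauge a ha)
  ae_eq_zero_of_profile_eq_zero hρ.le hsw hH hgauge hu
    (profile_eq_zero_of_compactCurlC2 hρ hρh hT₁ hTT₁ hsw.distributional hA hu hp hV hΩc)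

end Past

end Summit.NavierStokesRegularity.NavierStokesRegularity.Theorems.PowerGaugeEulerLiouville

end
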